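import Literature.AlgebraicGeometry.Resolution.PlaneNearPoints
import Literature.AlgebraicGeometry.Resolution.HironakaDirectrixSpan
import Literature.AlgebraicGeometry.Resolution.Dehomogenization
import HarnessLib

/-!
# Near points of the plane, III: initial forms near at a point of `ℙ²` are polynomials in the linear forms through it (Hironaka's Theorem 2, `r = 3`)

Topic: `Literature/AlgebraicGeometry/Resolution`. [CoP1] = Cossart–Piltant, J. Algebra 320 (2008),
proof of Prop. 4.2, p. 8, blowing up a closed point `x` of a regular threefold (`r = 3`):

> "By Hironaka's theorem 2 [25], `x′ ∈ Proj(Dir_x(E)) ⊆ Proj(k(x)[Y_1, …, Y_r])` if `x′` is very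
> near to `x`. This holds if `k` is perfect or if `char(k) ≥ dim(C_x(E))` which is the case here,
> since `dim R = 3`."

Homogeneous form of `PlaneNearPoints.mem_affineLinearIn_pow_of_mul_mem_pow`. A point `x′` of the
chart `Y_j ≠ 0` of `ℙ²_k` is a prime `𝔮` of `k[T_i : i ≠ j]`; write
`U(x′) ⊆ (k³)^∨` (`dualVanishingAt j 𝔮`) for the linear forms `L` with `L(T_j := 1) ∈ 𝔮` (the
`k`-rational lines of `ℙ²` through `x′`). PROVED:

* `subset_linearFormsSubalgebra_dualVanishingAt` — if every form `F` of a set `S` of forms of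
  degree `μ` is near at `x′` (`s · F(T_j := 1) ∈ 𝔮^μ` for some `s ∉ 𝔮`), then `S ⊆ k[U(x′)]`;
* `directrix_le_dualVanishingAt` — hence the directrix `T(S)` consists of forms vanishing at `x′`:
  **`x′ ∈ Proj(Dir(S))`** (Hironaka's Theorem 2 for `ℙ²`, every residue field, every
  characteristic);
* `hironakaTau_le_two_of_near` — so `τ(S) ≤ 2` if some point is near ([CoP1] Lemma 4.3 (1): "If
  `τ(x) = 3`, then … no `x′ ∈ q⁻¹(x)` is near `x`");
* `exists_eq_span_of_near_of_hironakaTau_eq_two` — if `τ(S) = 2` and `x′` is near then `x′` is the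
  `k`-rational point `𝔮 = (T_i − a_i : i ≠ j)` with `Y_i − a_i Y_j ∈ T(S)` ([CoP1] Lemma 4.3 (3):
  "`x′` is uniquely determined, rational over `x`"), and `eq_of_near_of_near_of_hironakaTau_eq_two`
  (uniqueness within a chart).

## Sources

* V. Cossart, O. Piltant, J. Algebra 320 (2008) 1051–1082, proof of Prop. 4.2 (p. 8), Lemma 4.3
  (1), (3), (5). [CossartPiltant2008]
* H. Hironaka, Ann. of Math. 92 (1970) 327–334, Thm. 2. [Hironaka1970] (statement; the proof is
  that of `PlaneNearPoints.lean`).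
-/

open MvPolynomial

noncomputable section

namespace Literature.AlgebraicGeometry.Resolution

universe u

variable {k : Type u} [Field k]

/-! ## Transport to any two-element set of variables -/

/-- `PlaneNearPoints.mem_affineLinearIn_pow_of_mul_mem_pow` for `k[T_σ]`, `σ ≃ Fin 2`.
[cite: Hironaka1970, Thm. 2; CossartPiltant2008, proof of Prop. 4.2, p. 8] -/
theorem mem_affineLinearIn_pow_of_mul_mem_pow_of_equiv {σ : Type*} (e : Fin 2 ≃ σ)
    (𝔮 : Ideal (MvPolynomial σ k)) [𝔮.IsPrime] {μ : ℕ} {s g : MvPolynomial σ k} (hs : s ∉ 𝔮)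
    (hsg : s * g ∈ 𝔮 ^ μ) (hdeg : g.totalDegree ≤ μ) : g ∈ affineLinearIn 𝔮 ^ μ := by
  classical
  obtain ⟨ψ, hψ⟩ : ∃ ψ : MvPolynomial (Fin 2) k ≃+* MvPolynomial σ k,
      ψ = (renameEquiv k e).toRingEquiv := ⟨_, rfl⟩
  have hψapply : ∀ p, ψ p = rename e p := fun p => by rw [hψ]; rfl
  have hψsymm : ∀ p, ψ.symm p = rename e.symm p := fun p => by rw [hψ]; rfl
  obtain ⟨𝔮', h𝔮'⟩ : ∃ 𝔮' : Ideal (MvPolynomial (Fin 2) k), 𝔮' = 𝔮.map ψ.symm := ⟨_, rfl⟩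
  have h𝔮'c : 𝔮' = 𝔮.comap ψ := by rw [h𝔮', Ideal.map_symm]
  haveI : 𝔮'.IsPrime := h𝔮'c ▸ Ideal.comap_isPrime ψ 𝔮
  have hs' : ψ.symm s ∉ 𝔮' := by
    rw [h𝔮'c, Ideal.mem_comap, RingEquiv.apply_symm_apply]; exact hs
  have hsg' : ψ.symm s * ψ.symm g ∈ 𝔮' ^ μ := by
    rw [h𝔮', ← Ideal.map_pow, Ideal.map_symm, Ideal.mem_comap, map_mul, RingEquiv.apply_symm_apply,
      RingEquiv.apply_symm_apply]
    exact hsg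
  have hdeg' : (ψ.symm g).totalDegree ≤ μ := by
    rw [hψsymm]; exact (totalDegree_rename_le _ _).trans hdeg
  have hmem := mem_affineLinearIn_pow_of_mul_mem_pow 𝔮' hs' hsg' hdeg'
  -- push forward along `rename e`
  have hle : Submodule.map (rename e : MvPolynomial (Fin 2) k →ₐ[k] MvPolynomial σ k).toLinearMap
      (affineLinearIn 𝔮') ≤ affineLinearIn 𝔮 := by
    rintro _ ⟨p, hp, rfl⟩
    rw [SetLike.mem_coe, mem_affineLinearIn_iff] at hp
    refine mem_affineLinearIn_iff.mpr ⟨(totalDegree_rename_le _ _).trans hp.1, ?_⟩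
    have h2 := hp.2
    rw [h𝔮'c, Ideal.mem_comap, hψapply] at h2
    exact h2
  have hg : g = (rename e : MvPolynomial (Fin 2) k →ₐ[k] MvPolynomial σ k).toLinearMap (ψ.symm g) := by
    change g = rename e (ψ.symm g)
    rw [← hψapply, RingEquiv.apply_symm_apply]
  rw [hg]
  refine pow_le_pow_left₀ bot_le hle μ ?_
  rw [← Submodule.map_pow]
  exact Submodule.mem_map_of_mem hmem

/-! ## Affine-linear polynomials and their homogenizations -/

/-- An exponent vector of degree `≤ 1` is `0` or a unit vector. [folklore] -/
theorem exists_eq_single_of_degree_le_one {σ : Type*} {d : σ →₀ ℕ} (h0 : d ≠ 0)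
    (h : (d.sum fun _ e => e) ≤ 1) : ∃ v, d = Finsupp.single v 1 := by
  rcases Nat.le_one_iff_eq_zero_or_eq_one.1 h with h | h
  · exact absurd ((Finsupp.degree_eq_zero_iff d).1 h) h0
  · exact (Finsupp.sum_eq_one_iff d).1 h

/-- **Affine decomposition**: a polynomial of total degree `≤ 1` is `p = p(0) + Σ_v c_v T_v` with
`c_v` the coefficient of `T_v`. [folklore] -/
theorem eq_C_add_sum_of_totalDegree_le_one {σ : Type*} [Fintype σ] (p : MvPolynomial σ k)
    (hp : p.totalDegree ≤ 1) :
    p = MvPolynomial.C (coeff 0 p) + ∑ v, MvPolynomial.C (coeff (Finsupp.single v 1) p) * X v := by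
  classical
  apply MvPolynomial.ext
  intro d
  simp only [MvPolynomial.coeff_add, MvPolynomial.coeff_C, MvPolynomial.coeff_sum,
    MvPolynomial.coeff_C_mul, MvPolynomial.coeff_X]
  by_cases h0 : d = 0
  · subst h0
    rw [if_pos rfl]
    have : ∀ v : σ, (Finsupp.single v 1 = (0 : σ →₀ ℕ)) = False := fun v =>
      propext ⟨fun h => one_ne_zero (Finsupp.single_eq_zero.1 h), False.elim⟩
    simp [this]
  · rw [if_neg (Ne.symm h0), zero_add]
    by_cases h1 : ∃ v, d = Finsupp.single v 1
    · obtain ⟨v, rfl⟩ := h1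
      rw [Finset.sum_eq_single v]
      · rw [if_pos rfl, mul_one]
      · intro w _ hw
        rw [if_neg (fun h => hw (Finsupp.single_left_injective one_ne_zero h)), mul_zero]
      · simp
    · have hd : coeff d p = 0 := by
        rw [← MvPolynomial.notMem_support_iff]
        intro hmem
        exact h1 (exists_eq_single_of_degree_le_one h0 ((le_totalDegree hmem).trans hp))
      rw [hd]
      symm
      refine Finset.sum_eq_zero fun v _ => ?_
      rw [if_neg (fun h => h1 ⟨v, h.symm⟩), mul_zero]

variable {d : ℕ} (j : Fin d)

/-- The coefficient vector of the HOMOGENIZATION (w.r.t. `Y_j`) of an affine-linear polynomial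
`p ∈ k[T_i : i ≠ j]`: `a_i = ` coefficient of `T_i` (`i ≠ j`), `a_j = p(0)`. [folklore] -/
def homogCoeff (p : MvPolynomial {i : Fin d // i ≠ j} k) (i : Fin d) : k :=
  if h : i = j then coeff 0 p else coeff (Finsupp.single ⟨i, h⟩ 1) p

/-- `a_j = p(0)`. [folklore] -/
theorem homogCoeff_self (p : MvPolynomial {i : Fin d // i ≠ j} k) : homogCoeff j p j = coeff 0 p :=
  dif_pos rfl

/-- `a_i = ` coefficient of `T_i` for `i ≠ j`. [folklore] -/
theorem homogCoeff_of_ne (p : MvPolynomial {i : Fin d // i ≠ j} k) {i : Fin d} (h : i ≠ j) :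
    homogCoeff j p i = coeff (Finsupp.single ⟨i, h⟩ 1) p :=
  dif_neg h

/-- The linear functional `Σ_i a_i Y_i^∨` with the homogenized coefficients. [folklore] -/
def homogDual (p : MvPolynomial {i : Fin d // i ≠ j} k) : Module.Dual k (Fin d → k) :=
  ∑ i, homogCoeff j p i • (LinearMap.proj i : Module.Dual k (Fin d → k))

/-- `homogDual p (e_i) = a_i`. [folklore] -/
theorem homogDual_single (p : MvPolynomial {i : Fin d // i ≠ j} k) (i : Fin d) :
    homogDual j p (Pi.single i 1) = homogCoeff j p i := by
  classical
  simp only [homogDual, LinearMap.coe_sum, Finset.sum_apply, LinearMap.smul_apply,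
    LinearMap.coe_proj, Function.eval, Pi.single_apply, smul_eq_mul, mul_ite, mul_one, mul_zero,
    Finset.sum_ite_eq', Finset.mem_univ, if_true]

/-- The homogenization as a polynomial: `Σ_i a_i Y_i`. [folklore] -/
theorem linearFormPoly_homogDual (p : MvPolynomial {i : Fin d // i ≠ j} k) :
    linearFormPoly k (homogDual j p) = ∑ i, MvPolynomial.C (homogCoeff j p i) * X i := by
  simp only [linearFormPoly, homogDual_single]

/-- **Dehomogenizing the homogenization gives back the affine-linear polynomial.** [folklore] -/
theorem dehomogenize_linearFormPoly_homogDual {p : MvPolynomial {i : Fin d // i ≠ j} k}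
    (hp : p.totalDegree ≤ 1) : dehomogenize j (linearFormPoly k (homogDual j p)) = p := by
  classical
  rw [linearFormPoly_homogDual, map_sum]
  simp only [map_mul, dehomogenize, MvPolynomial.aeval_X, MvPolynomial.aeval_C,
    MvPolynomial.algebraMap_eq]
  conv_rhs => rw [eq_C_add_sum_of_totalDegree_le_one p hp]
  rw [← Finset.sum_erase_add _ _ (Finset.mem_univ j), killVar_self, mul_one, homogCoeff_self,
    add_comm]
  congr 1
  -- the sum over `i ≠ j`
  rw [Finset.sum_subtype (Finset.univ.erase j) (p := fun i => i ≠ j)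
    (fun i => by simp [Finset.mem_erase])]
  refine Finset.sum_congr rfl fun i _ => ?_
  rw [killVar_of_ne j i.2, homogCoeff_of_ne j p i.2]

/-- The homogenization of an affine-linear polynomial is a linear form (homogeneous of degree one).
[folklore] -/
theorem isHomogeneous_linearFormPoly (ℓ : Module.Dual k (Fin d → k)) :
    (linearFormPoly k ℓ).IsHomogeneous 1 := by
  rw [linearFormPoly]
  refine MvPolynomial.IsHomogeneous.sum _ _ _ fun i _ => ?_
  simpa using (isHomogeneous_C _ (ℓ (Pi.single i 1))).mul (isHomogeneous_X k i)

/-! ## Rational points of affine space -/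

/-- `g − g(a) ∈ (T_i − a_i : i)`. [folklore] -/
theorem sub_C_eval_mem_span_range_X_sub_C {σ : Type*} (g : MvPolynomial σ k) (a : σ → k) :
    g - MvPolynomial.C (MvPolynomial.eval a g) ∈
      Ideal.span (Set.range fun i => (X i - MvPolynomial.C (a i) : MvPolynomial σ k)) := by
  induction g using MvPolynomial.induction_on with
  | C b => rw [MvPolynomial.eval_C, sub_self]; exact Ideal.zero_mem _
  | add p q hp hq =>
    have : p + q - MvPolynomial.C (MvPolynomial.eval a (p + q)) =
        (p - MvPolynomial.C (MvPolynomial.eval a p)) + (q - MvPolynomial.C (MvPolynomial.eval a q)) := by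
      rw [map_add, map_add]; ring
    rw [this]; exact Ideal.add_mem _ hp hq
  | mul_X p i hp =>
    have : p * X i - MvPolynomial.C (MvPolynomial.eval a (p * X i)) =
        (p - MvPolynomial.C (MvPolynomial.eval a p)) * X i +
          MvPolynomial.C (MvPolynomial.eval a p) * (X i - MvPolynomial.C (a i)) := by
      rw [map_mul, MvPolynomial.eval_X, map_mul]; ring
    rw [this]
    exact Ideal.add_mem _ (Ideal.mul_mem_right _ _ hp)
      (Ideal.mul_mem_left _ _ (Ideal.subset_span ⟨i, rfl⟩))

/-- **The ideal of a rational point is maximal**: `(T_i − a_i : i) ⊂ k[T_σ]` is a maximal ideal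
(the quotient is `k`, via `g ↦ g(a)`). [folklore] -/
theorem isMaximal_span_range_X_sub_C {σ : Type*} (a : σ → k) :
    (Ideal.span (Set.range fun i => (X i - MvPolynomial.C (a i) : MvPolynomial σ k))).IsMaximal := by
  have hker : RingHom.ker (MvPolynomial.eval a : MvPolynomial σ k →+* k) =
      Ideal.span (Set.range fun i => (X i - MvPolynomial.C (a i) : MvPolynomial σ k)) := by
    refine le_antisymm (fun g hg => ?_) (Ideal.span_le.mpr ?_)
    · rw [RingHom.mem_ker] at hg
      have h := sub_C_eval_mem_span_range_X_sub_C g a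
      rwa [hg, map_zero, sub_zero] at h
    · rintro _ ⟨i, rfl⟩
      rw [SetLike.mem_coe, RingHom.mem_ker, map_sub, MvPolynomial.eval_X, MvPolynomial.eval_C,
        sub_self]
  rw [← hker]
  exact RingHom.ker_isMaximal_of_surjective (MvPolynomial.eval a)
    fun b => ⟨MvPolynomial.C b, MvPolynomial.eval_C b⟩

/-! ## The `k`-rational lines through a point of the chart -/

/-- **`U(x′)`**: for a point `x′ = 𝔮` of the chart `Y_j ≠ 0`, the linear forms `L` on `k^d` with
`L(T_j := 1) ∈ 𝔮` — the `k`-rational hyperplanes of `ℙ^{d-1}` through `x′`. A `k`-subspace.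
[folklore] -/
def dualVanishingAt (𝔮 : Ideal (MvPolynomial {i : Fin d // i ≠ j} k)) :
    Submodule k (Module.Dual k (Fin d → k)) :=
  (𝔮.restrictScalars k).comap ((dehomogenize j : MvPolynomial (Fin d) k →ₐ[k] _).toLinearMap ∘ₗ
    linearFormPolyₗ k)

/-- Membership in `U(x′)`. [folklore] -/
theorem mem_dualVanishingAt_iff {𝔮 : Ideal (MvPolynomial {i : Fin d // i ≠ j} k)}
    {ℓ : Module.Dual k (Fin d → k)} :
    ℓ ∈ dualVanishingAt j 𝔮 ↔ dehomogenize j (linearFormPoly k ℓ) ∈ 𝔮 :=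
  Iff.rfl

/-- `Y_j ∉ U(x′)` (its dehomogenization is `1`). [folklore] -/
theorem proj_not_mem_dualVanishingAt (𝔮 : Ideal (MvPolynomial {i : Fin d // i ≠ j} k))
    [𝔮.IsPrime] : (LinearMap.proj j : Module.Dual k (Fin d → k)) ∉ dualVanishingAt j 𝔮 := by
  rw [mem_dualVanishingAt_iff, linearFormPoly_proj]
  change MvPolynomial.aeval (killVar j) (X j) ∉ 𝔮
  rw [MvPolynomial.aeval_X, killVar_self]
  exact (Ideal.ne_top_iff_one 𝔮).mp Ideal.IsPrime.ne_top'

/-- Hence `U(x′) ≠ ⊤`. [folklore] -/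
theorem dualVanishingAt_ne_top (𝔮 : Ideal (MvPolynomial {i : Fin d // i ≠ j} k)) [𝔮.IsPrime] :
    dualVanishingAt j 𝔮 ≠ ⊤ := fun h =>
  proj_not_mem_dualVanishingAt j 𝔮 (h ▸ Submodule.mem_top)

/-- The homogenization of an affine-linear element of `𝔮` lies in `U(x′)`. [folklore] -/
theorem homogDual_mem_dualVanishingAt {𝔮 : Ideal (MvPolynomial {i : Fin d // i ≠ j} k)}
    {p : MvPolynomial {i : Fin d // i ≠ j} k} (hp : p ∈ affineLinearIn 𝔮) :
    homogDual j p ∈ dualVanishingAt j 𝔮 := by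
  rw [mem_affineLinearIn_iff] at hp
  rw [mem_dualVanishingAt_iff, dehomogenize_linearFormPoly_homogDual j hp.1]
  exact hp.2

/-! ## Hironaka's Theorem 2 for `ℙ²` -/

/-- **Homogenization of `U′(𝔮)^n`**: every element of `U′(𝔮)^n` is the dehomogenization of a form
of degree `n` lying in `k[U(x′)]`. [folklore] -/
theorem exists_isHomogeneous_mem_dehomogenize_eq {𝔮 : Ideal (MvPolynomial {i : Fin d // i ≠ j} k)}
    {n : ℕ} {x : MvPolynomial {i : Fin d // i ≠ j} k} (hx : x ∈ affineLinearIn 𝔮 ^ n) :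
    ∃ G : MvPolynomial (Fin d) k, G.IsHomogeneous n ∧
      G ∈ linearFormsSubalgebra k (dualVanishingAt j 𝔮) ∧ dehomogenize j G = x := by
  classical
  induction hx using Submodule.pow_induction_on_right' with
  | algebraMap r =>
    refine ⟨C r, isHomogeneous_C _ r, Subalgebra.algebraMap_mem _ r, ?_⟩
    rw [MvPolynomial.algHom_C, MvPolynomial.algebraMap_eq]
  | add x y i hx hy ihx ihy =>
    obtain ⟨G, hG, hGm, hGx⟩ := ihx
    obtain ⟨H, hH, hHm, hHy⟩ := ihy
    exact ⟨G + H, hG.add hH, Subalgebra.add_mem _ hGm hHm, by rw [map_add, hGx, hHy]⟩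
  | mul_mem i x hx ihx m hm =>
    obtain ⟨G, hG, hGm, hGx⟩ := ihx
    refine ⟨G * linearFormPoly k (homogDual j m), hG.mul (isHomogeneous_linearFormPoly _),
      Subalgebra.mul_mem _ hGm (Algebra.subset_adjoin ⟨homogDual j m,
        homogDual_mem_dualVanishingAt j hm, rfl⟩), ?_⟩
    rw [map_mul, hGx, dehomogenize_linearFormPoly_homogDual j (mem_affineLinearIn_iff.mp hm).1]

/-- **Near forms are polynomials in the linear forms through the near point** (`r = 3`): let `𝔮`
be a point of the chart `Y_j ≠ 0` of `ℙ²_k` and `S` a set of forms of degree `μ` in `Y_0, Y_1, Y_2`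
each of which is near at `𝔮` (`s · F(T_j := 1) ∈ 𝔮^μ` for some `s ∉ 𝔮`). Then `S ⊆ k[U(x′)]`.
[cite: Hironaka1970, Thm. 2; CossartPiltant2008, proof of Prop. 4.2, p. 8] -/
theorem subset_linearFormsSubalgebra_dualVanishingAt (j : Fin 3)
    (𝔮 : Ideal (MvPolynomial {i : Fin 3 // i ≠ j} k)) [𝔮.IsPrime] {S : Set (MvPolynomial (Fin 3) k)}
    {μ : ℕ} (hS : ∀ F ∈ S, F.IsHomogeneous μ ∧ ∃ s ∉ 𝔮, s * dehomogenize j F ∈ 𝔮 ^ μ) :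
    S ⊆ linearFormsSubalgebra k (dualVanishingAt j 𝔮) := by
  classical
  intro F hF
  obtain ⟨hFh, s, hs, hsg⟩ := hS F hF
  have hdeg : (dehomogenize j F).totalDegree ≤ μ :=
    (totalDegree_dehomogenize_le j F).trans hFh.totalDegree_le
  have hmem : dehomogenize j F ∈ affineLinearIn 𝔮 ^ μ :=
    mem_affineLinearIn_pow_of_mul_mem_pow_of_equiv (finSuccAboveEquiv j) 𝔮 hs hsg hdeg
  obtain ⟨G, hG, hGm, hGF⟩ := exists_isHomogeneous_mem_dehomogenize_eq j hmem
  have hFG : F = G := by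
    by_contra hne
    have h := dehomogenize_ne_zero_of_isHomogeneous j (hFh.sub hG) (sub_ne_zero.mpr hne)
    rw [map_sub, hGF, sub_self] at h
    exact h rfl
  rw [hFG]
  exact hGm

/-- **Hironaka's Theorem 2 for `ℙ²`: a near point lies on the projective directrix.** In the
situation of `subset_linearFormsSubalgebra_dualVanishingAt`, the directrix `T(S)` consists of
linear forms vanishing at `x′` (`T(S) ≤ U(x′)`, by minimality of the directrix); in [CoP1]'s words,
`x′ ∈ Proj(Dir_x(E))`. For every residue field and characteristic.
[cite: Hironaka1970, Thm. 2; CossartPiltant2008, proof of Prop. 4.2, p. 8] -/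
theorem directrix_le_dualVanishingAt (j : Fin 3)
    (𝔮 : Ideal (MvPolynomial {i : Fin 3 // i ≠ j} k)) [𝔮.IsPrime] {S : Set (MvPolynomial (Fin 3) k)}
    {μ : ℕ} (hS : ∀ F ∈ S, F.IsHomogeneous μ ∧ ∃ s ∉ 𝔮, s * dehomogenize j F ∈ 𝔮 ^ μ) :
    directrix k S ≤ dualVanishingAt j 𝔮 :=
  directrix_le_of_subset k (subset_linearFormsSubalgebra_dualVanishingAt j 𝔮 hS)

/-- **[CoP1] Lemma 4.3 (1) (form level): `τ = 3` admits no near point.** If some point of the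
chart `Y_j ≠ 0` of `ℙ²` is near for all forms of `S`, then `τ(S) ≤ 2` (`T(S) ≤ U(x′) ∌ Y_j`).
[cite: CossartPiltant2008, Lemma 4.3 (1); Hironaka1970, Thm. 2] -/
theorem hironakaTau_le_two_of_near (j : Fin 3)
    (𝔮 : Ideal (MvPolynomial {i : Fin 3 // i ≠ j} k)) [𝔮.IsPrime] {S : Set (MvPolynomial (Fin 3) k)}
    {μ : ℕ} (hS : ∀ F ∈ S, F.IsHomogeneous μ ∧ ∃ s ∉ 𝔮, s * dehomogenize j F ∈ 𝔮 ^ μ) :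
    hironakaTau k S ≤ 2 := by
  have hle := directrix_le_dualVanishingAt j 𝔮 hS
  have hlt : Module.finrank k (dualVanishingAt j 𝔮) < Module.finrank k (Module.Dual k (Fin 3 → k)) :=
    Submodule.finrank_lt (dualVanishingAt_ne_top j 𝔮)
  rw [Subspace.dual_finrank_eq, Module.finrank_fin_fun] at hlt
  exact (Submodule.finrank_mono hle).trans (by omega)

/-- **[CoP1] Lemma 4.3 (3) (form level): at `τ = 2` a near point is the rational point cut out by
the directrix.** If `τ(S) = 2` and the point `𝔮` of the chart `Y_j ≠ 0` is near for all forms of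
`S`, then `T(S) = U(x′)`, and there are `a_i ∈ k` (`i ≠ j`) with `Y_i − a_i Y_j ∈ T(S)` and
`𝔮 = (T_i − a_i : i ≠ j)`: the point is `k`-rational and determined by `T(S)`.
[cite: CossartPiltant2008, Lemma 4.3 (3); Hironaka1970, Thm. 2] -/
theorem exists_eq_span_of_near_of_hironakaTau_eq_two (j : Fin 3)
    (𝔮 : Ideal (MvPolynomial {i : Fin 3 // i ≠ j} k)) [𝔮.IsPrime] {S : Set (MvPolynomial (Fin 3) k)}
    {μ : ℕ} (hS : ∀ F ∈ S, F.IsHomogeneous μ ∧ ∃ s ∉ 𝔮, s * dehomogenize j F ∈ 𝔮 ^ μ)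
    (hτ : hironakaTau k S = 2) :
    directrix k S = dualVanishingAt j 𝔮 ∧
      ∃ a : {i : Fin 3 // i ≠ j} → k,
        (∀ i, (LinearMap.proj i.1 - a i • LinearMap.proj j : Module.Dual k (Fin 3 → k)) ∈ directrix k S) ∧
        𝔮 = Ideal.span (Set.range fun i => X i - MvPolynomial.C (a i)) := by
  classical
  have hle := directrix_le_dualVanishingAt j 𝔮 hS
  have hlt : Module.finrank k (dualVanishingAt j 𝔮) < Module.finrank k (Module.Dual k (Fin 3 → k)) :=
    Submodule.finrank_lt (dualVanishingAt_ne_top j 𝔮)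
  rw [Subspace.dual_finrank_eq, Module.finrank_fin_fun] at hlt
  have hτ' : Module.finrank k (directrix k S) = 2 := hτ
  have heq : directrix k S = dualVanishingAt j 𝔮 :=
    Submodule.eq_of_le_of_finrank_le hle (by omega)
  refine ⟨heq, ?_⟩
  -- `U(x′) ⊕ k Y_j = ⊤`: each `Y_i` is `u + a Y_j` with `u ∈ U(x′)`
  have hsup : dualVanishingAt j 𝔮 ⊔ k ∙ (LinearMap.proj j : Module.Dual k (Fin 3 → k)) = ⊤ := by
    apply Submodule.eq_top_of_finrank_eq
    rw [Subspace.dual_finrank_eq, Module.finrank_fin_fun]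
    have hdisj : Disjoint (dualVanishingAt j 𝔮) (k ∙ (LinearMap.proj j : Module.Dual k (Fin 3 → k))) := by
      rw [Submodule.disjoint_span_singleton']
      · exact proj_not_mem_dualVanishingAt j 𝔮
      · intro h0
        exact proj_not_mem_dualVanishingAt j 𝔮 (h0 ▸ Submodule.zero_mem _)
    have h1 := Submodule.finrank_sup_add_finrank_inf_eq (dualVanishingAt j 𝔮)
      (k ∙ (LinearMap.proj j : Module.Dual k (Fin 3 → k)))
    have hU : Module.finrank k (dualVanishingAt j 𝔮) = 2 := by rw [← heq]; exact hτ'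
    rw [hdisj.eq_bot, finrank_bot, add_zero, finrank_span_singleton, hU] at h1
    · omega
    · intro h0
      exact proj_not_mem_dualVanishingAt j 𝔮 (h0 ▸ Submodule.zero_mem _)
  have hproj : ∀ i : {i : Fin 3 // i ≠ j}, ∃ a : k,
      (LinearMap.proj i.1 - a • LinearMap.proj j : Module.Dual k (Fin 3 → k)) ∈ dualVanishingAt j 𝔮 := by
    intro i
    have hmem : (LinearMap.proj i.1 : Module.Dual k (Fin 3 → k)) ∈
        dualVanishingAt j 𝔮 ⊔ k ∙ (LinearMap.proj j : Module.Dual k (Fin 3 → k)) := by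
      rw [hsup]; exact Submodule.mem_top
    obtain ⟨u, hu, w, hw, huw⟩ := Submodule.mem_sup.mp hmem
    obtain ⟨a, rfl⟩ := Submodule.mem_span_singleton.mp hw
    refine ⟨a, ?_⟩
    rw [← huw, add_sub_cancel_right]
    exact hu
  choose a ha using hproj
  refine ⟨a, fun i => heq ▸ ha i, ?_⟩
  -- `𝔮 ⊇ (T_i − a_i)`, a maximal ideal
  have hgen : ∀ i : {i : Fin 3 // i ≠ j}, X i - MvPolynomial.C (a i) ∈ 𝔮 := by
    intro i
    have h := ha i
    rw [mem_dualVanishingAt_iff, ← linearFormPolyₗ_apply, map_sub, map_smul, linearFormPolyₗ_apply,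
      linearFormPolyₗ_apply, linearFormPoly_proj, linearFormPoly_proj, map_sub, map_smul] at h
    change MvPolynomial.aeval (killVar j) (X i.1) - a i • MvPolynomial.aeval (killVar j) (X j) ∈ 𝔮 at h
    rw [MvPolynomial.aeval_X, MvPolynomial.aeval_X, killVar_self, killVar_of_ne j i.2,
      MvPolynomial.smul_eq_C_mul, mul_one] at h
    exact h
  have hle' : Ideal.span (Set.range fun i => X i - MvPolynomial.C (a i)) ≤ 𝔮 :=
    Ideal.span_le.mpr (by rintro _ ⟨i, rfl⟩; exact hgen i)
  haveI hmax : (Ideal.span (Set.range fun i : {i : Fin 3 // i ≠ j} =>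
      (X i - MvPolynomial.C (a i) : MvPolynomial {i : Fin 3 // i ≠ j} k))).IsMaximal :=
    isMaximal_span_range_X_sub_C a
  exact (hmax.eq_of_le Ideal.IsPrime.ne_top' hle').symm

/-- **Uniqueness of the near point within a chart at `τ = 2`**: two points of the chart `Y_j ≠ 0`
near for all forms of `S` with `τ(S) = 2` coincide. [cite: CossartPiltant2008, Lemma 4.3 (3)] -/
theorem eq_of_near_of_near_of_hironakaTau_eq_two (j : Fin 3)
    (𝔮 𝔮' : Ideal (MvPolynomial {i : Fin 3 // i ≠ j} k)) [𝔮.IsPrime] [𝔮'.IsPrime]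
    {S : Set (MvPolynomial (Fin 3) k)} {μ : ℕ}
    (hS : ∀ F ∈ S, F.IsHomogeneous μ ∧ ∃ s ∉ 𝔮, s * dehomogenize j F ∈ 𝔮 ^ μ)
    (hS' : ∀ F ∈ S, F.IsHomogeneous μ ∧ ∃ s ∉ 𝔮', s * dehomogenize j F ∈ 𝔮' ^ μ)
    (hτ : hironakaTau k S = 2) : 𝔮 = 𝔮' := by
  obtain ⟨h1, -⟩ := exists_eq_span_of_near_of_hironakaTau_eq_two j 𝔮 hS hτ
  obtain ⟨h2, -⟩ := exists_eq_span_of_near_of_hironakaTau_eq_two j 𝔮' hS' hτ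
  have heq : dualVanishingAt j 𝔮 = dualVanishingAt j 𝔮' := h1.symm.trans h2
  -- both are the span of their affine-linear elements? use the rational-point description
  obtain ⟨-, a, ha, h𝔮⟩ := exists_eq_span_of_near_of_hironakaTau_eq_two j 𝔮 hS hτ
  obtain ⟨-, a', ha', h𝔮'⟩ := exists_eq_span_of_near_of_hironakaTau_eq_two j 𝔮' hS' hτ
  have haa : a = a' := by
    funext i
    have hd : ((a' i - a i) • LinearMap.proj j : Module.Dual k (Fin 3 → k)) ∈ directrix k S := by
      convert Submodule.sub_mem _ (ha i) (ha' i) using 1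
      module
    by_contra hne
    have hne' : a' i - a i ≠ 0 := sub_ne_zero.mpr (Ne.symm hne)
    have : (LinearMap.proj j : Module.Dual k (Fin 3 → k)) ∈ directrix k S := by
      have h := Submodule.smul_mem _ (a' i - a i)⁻¹ hd
      rwa [smul_smul, inv_mul_cancel₀ hne', one_smul] at h
    rw [h1] at this
    exact proj_not_mem_dualVanishingAt j 𝔮 this
  rw [h𝔮, h𝔮', haa]

/-- **[CoP1] Lemma 4.3 (5) (form level): at `τ = 1` the near points lie on the line `Proj(Dir)`.**
If `T(S) = k · L` then `L(T_j := 1) ∈ 𝔮` for every point `𝔮` of the chart `Y_j ≠ 0` near for all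
forms of `S`. [cite: CossartPiltant2008, Lemma 4.3 (5); Hironaka1970, Thm. 2] -/
theorem dehomogenize_linearFormPoly_mem_of_near (j : Fin 3)
    (𝔮 : Ideal (MvPolynomial {i : Fin 3 // i ≠ j} k)) [𝔮.IsPrime] {S : Set (MvPolynomial (Fin 3) k)}
    {μ : ℕ} (hS : ∀ F ∈ S, F.IsHomogeneous μ ∧ ∃ s ∉ 𝔮, s * dehomogenize j F ∈ 𝔮 ^ μ)
    {L : Module.Dual k (Fin 3 → k)} (hL : L ∈ directrix k S) :
    dehomogenize j (linearFormPoly k L) ∈ 𝔮 :=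
  (mem_dualVanishingAt_iff j).mp (directrix_le_dualVanishingAt j 𝔮 hS hL)

end Literature.AlgebraicGeometry.Resolution

end
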